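import Literature.MathematicalPhysics.KineticTheory.ReyBelletThomas2002Proofs
import HarnessLib

/-!
# Rey-Bellet–Thomas 2002, Lemma 3.5: the generator on functions of the energy, `L e^{θG}`

Topic `Literature/MathematicalPhysics/KineticTheory` (trunk T-KINETIC). Provefact unit for the
named fact `ReyBelletThomas2002_thm21` (`ReyBelletThomas2002.lean`, Rey-Bellet–Thomas 2002,
Theorem 2.1): a first PROVED ingredient of its printed proof, the pointwise computation behind
the "no-runaway" bound of Lemma 3.5 (and behind the continuous-time step of §5): for the
generator `L = rbGenerator` (RBT eq. (13)) and the energy `G = rbEnergy`,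

`L exp(θG(x)) = γθ exp(θG(x)) (Tr(T) - r(1 - θT)r) ≤ γθ Tr(T) exp(θG(x))` for `θ ≤ (max{T_1,T_n})⁻¹`

(RBT 2002, proof of Lemma 3.5, the display (28) of arXiv:math-ph/0110024 p. 18; Remark 3.6: "The
assumption on `θ` here arises naturally in the proof, where we need `(1 - θT) ≥ 0`"). Here
`Tr(T) = T_L + T_R` and `r(1 - θT)r = r_L²(1 - θT_L) + r_R²(1 - θT_R)`.

## Contents (theorems only; no definitions, no named facts)

* `OscillatorChain.rbGenerator_comp_rbEnergy` — for a differentiable Hamiltonian and `F ∈ C²(ℝ)`,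
  `L(F∘G) = γ [T_L (F''(G) r_L² + F'(G)) - F'(G) r_L² + T_R (F''(G) r_R² + F'(G)) - F'(G) r_R²]`:
  the Liouville part and the two coupling parts `λ(p_b ∂_{r_b} - r_b ∂_{p_b})` annihilate every
  function of `G` (they are derivations along vector fields tangent to `{G = const}`), and each
  reservoir contributes its Ornstein–Uhlenbeck term `γ(T_b ∂²_{r_b} - r_b ∂_{r_b}) F(G)`. This is
  the form needed later with smooth cutoffs `F` of the exponential (Dynkin's formula is only
  available on `C_c^∞`).
* `OscillatorChain.rbGenerator_exp_mul_rbEnergy` — RBT (28), the identity.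
* `OscillatorChain.rbGenerator_exp_mul_rbEnergy_le` — RBT (28), the inequality
  `L e^{θG} ≤ γθ(T_L + T_R) e^{θG}` for `γ ≥ 0`, `θ ≥ 0`, `θT_L ≤ 1`, `θT_R ≤ 1`.
* `OscillatorChain.rbGenerator_rbEnergy` — the energy balance `L G = γ(T_L + T_R) - γ(r_L² + r_R²)`.

The coordinate derivatives `rbPartialQ/rbPartialP/partialRL/partialRR` of `ReyBelletThomas2002.lean`
are handled through their identification with line derivatives and the directional derivatives
of `G` proved in `ReyBelletThomas2002Proofs.lean`.

## References

* L. Rey-Bellet, L. E. Thomas, *Exponential convergence to non-equilibrium stationary states in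
  classical statistical mechanics*, Comm. Math. Phys. **225** (2002) 305–329
  (arXiv:math-ph/0110024): §2 eq. (13) (generator), Lemma 3.5 and its proof (arXiv display (28)),
  Remark 3.6.
* L. Rey-Bellet, *Open classical systems*, LNM **1881** (2006), §3 eqs. (71), (73).
-/

noncomputable section

namespace Literature.MathematicalPhysics.KineticTheory.HeatConduction

variable {N : ℕ}

/-- The coordinate function `r_L` has line derivative `1` along `(0, (1, 0))`. [folklore] -/
theorem hasLineDerivAt_rL_unitRL (x : RBPhaseSpace N) :
    HasLineDerivAt ℝ (fun y : RBPhaseSpace N => y.2.1) 1 x ((0, (1, 0)) : RBPhaseSpace N) := by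
  unfold HasLineDerivAt
  have e : (fun t : ℝ => (x + t • ((0, (1, 0)) : RBPhaseSpace N)).2.1) = fun t => x.2.1 + t := by
    funext t
    simp only [Prod.snd_add, Prod.fst_add, Prod.smul_mk, smul_eq_mul, mul_one, mul_zero]
  rw [e]
  exact (hasDerivAt_id' (0 : ℝ)).const_add _

/-- The coordinate function `r_R` has line derivative `1` along `(0, (0, 1))`. [folklore] -/
theorem hasLineDerivAt_rR_unitRR (x : RBPhaseSpace N) :
    HasLineDerivAt ℝ (fun y : RBPhaseSpace N => y.2.2) 1 x ((0, (0, 1)) : RBPhaseSpace N) := by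
  unfold HasLineDerivAt
  have e : (fun t : ℝ => (x + t • ((0, (0, 1)) : RBPhaseSpace N)).2.2) = fun t => x.2.2 + t := by
    funext t
    simp only [Prod.snd_add, Prod.smul_mk, smul_eq_mul, mul_one, mul_zero]
  rw [e]
  exact (hasDerivAt_id' (0 : ℝ)).const_add _

namespace OscillatorChain

variable (P : OscillatorChain)

/-! ### Chain rule: derivatives of `F∘G` along the coordinate directions -/

/-- Chain rule along a direction: if `∂_v G(x) = D` and `F' = dF/du`, then
`∂_v (F∘G)(x) = F'(G(x)) D`. [folklore] -/
theorem hasLineDerivAt_comp_rbEnergy {F F' : ℝ → ℝ} (hF : ∀ u, HasDerivAt F (F' u) u)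
    {x v : RBPhaseSpace N} {D : ℝ} (hG : HasLineDerivAt ℝ (P.rbEnergy N) D x v) :
    HasLineDerivAt ℝ (fun y => F (P.rbEnergy N y)) (F' (P.rbEnergy N x) * D) x v := by
  unfold HasLineDerivAt at hG ⊢
  have h := (hF _).comp 0 hG
  simpa [Function.comp_def] using h

/-- `∂_{q_i} F(G) = F'(G) ∂_{q_i} H` (differentiable Hamiltonian). [folklore] -/
theorem rbPartialQ_comp_rbEnergy (hH : Differentiable ℝ (P.hamiltonian N)) {F F' : ℝ → ℝ}
    (hF : ∀ u, HasDerivAt F (F' u) u) (i : Fin N) (x : RBPhaseSpace N) :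
    rbPartialQ i (fun y => F (P.rbEnergy N y)) x =
      F' (P.rbEnergy N x) * partialQ i (P.hamiltonian N) x.1 := by
  rw [rbPartialQ_eq_lineDeriv]
  exact (P.hasLineDerivAt_comp_rbEnergy hF (P.hasLineDerivAt_rbEnergy_unitQ hH x i)).lineDeriv

/-- `∂_{p_i} F(G) = F'(G) p_i`. [folklore] -/
theorem rbPartialP_comp_rbEnergy {F F' : ℝ → ℝ} (hF : ∀ u, HasDerivAt F (F' u) u) (i : Fin N)
    (x : RBPhaseSpace N) :
    rbPartialP i (fun y => F (P.rbEnergy N y)) x = F' (P.rbEnergy N x) * x.1.2 i := by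
  rw [rbPartialP_eq_lineDeriv]
  exact (P.hasLineDerivAt_comp_rbEnergy hF (P.hasLineDerivAt_rbEnergy_unitP N x i)).lineDeriv

/-- `∂_{r_L} F(G) = F'(G) r_L` (as functions). [folklore] -/
theorem partialRL_comp_rbEnergy {F F' : ℝ → ℝ} (hF : ∀ u, HasDerivAt F (F' u) u) :
    partialRL (fun y : RBPhaseSpace N => F (P.rbEnergy N y)) =
      fun x => F' (P.rbEnergy N x) * x.2.1 := by
  rw [partialRL_eq_lineDeriv]
  funext x
  exact (P.hasLineDerivAt_comp_rbEnergy hF (P.hasLineDerivAt_rbEnergy_unitRL N x)).lineDeriv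

/-- `∂_{r_R} F(G) = F'(G) r_R` (as functions). [folklore] -/
theorem partialRR_comp_rbEnergy {F F' : ℝ → ℝ} (hF : ∀ u, HasDerivAt F (F' u) u) :
    partialRR (fun y : RBPhaseSpace N => F (P.rbEnergy N y)) =
      fun x => F' (P.rbEnergy N x) * x.2.2 := by
  rw [partialRR_eq_lineDeriv]
  funext x
  exact (P.hasLineDerivAt_comp_rbEnergy hF (P.hasLineDerivAt_rbEnergy_unitRR N x)).lineDeriv

/-- `∂_{r_L} (F'(G) r_L) = F''(G) r_L² + F'(G)`. [folklore] -/
theorem partialRL_deriv_comp_rbEnergy_mul {F' F'' : ℝ → ℝ} (hF' : ∀ u, HasDerivAt F' (F'' u) u)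
    (x : RBPhaseSpace N) :
    partialRL (fun y : RBPhaseSpace N => F' (P.rbEnergy N y) * y.2.1) x =
      F'' (P.rbEnergy N x) * x.2.1 ^ 2 + F' (P.rbEnergy N x) := by
  rw [partialRL_eq_lineDeriv]
  have h1 := hasLineDerivAt_rL_unitRL x
  have h2 := P.hasLineDerivAt_comp_rbEnergy hF' (P.hasLineDerivAt_rbEnergy_unitRL N x)
  have h12 : HasLineDerivAt ℝ (fun y : RBPhaseSpace N => F' (P.rbEnergy N y) * y.2.1)
      (F'' (P.rbEnergy N x) * x.2.1 * x.2.1 + F' (P.rbEnergy N x) * 1) x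
      ((0, (1, 0)) : RBPhaseSpace N) := by
    unfold HasLineDerivAt at h1 h2 ⊢
    have h := h2.mul h1
    simpa [Pi.mul_def] using h
  show lineDeriv ℝ (fun y : RBPhaseSpace N => F' (P.rbEnergy N y) * y.2.1) x
      ((0, (1, 0)) : RBPhaseSpace N) = _
  rw [h12.lineDeriv]
  ring

/-- `∂_{r_R} (F'(G) r_R) = F''(G) r_R² + F'(G)`. [folklore] -/
theorem partialRR_deriv_comp_rbEnergy_mul {F' F'' : ℝ → ℝ} (hF' : ∀ u, HasDerivAt F' (F'' u) u)
    (x : RBPhaseSpace N) :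
    partialRR (fun y : RBPhaseSpace N => F' (P.rbEnergy N y) * y.2.2) x =
      F'' (P.rbEnergy N x) * x.2.2 ^ 2 + F' (P.rbEnergy N x) := by
  rw [partialRR_eq_lineDeriv]
  have h1 := hasLineDerivAt_rR_unitRR x
  have h2 := P.hasLineDerivAt_comp_rbEnergy hF' (P.hasLineDerivAt_rbEnergy_unitRR N x)
  have h12 : HasLineDerivAt ℝ (fun y : RBPhaseSpace N => F' (P.rbEnergy N y) * y.2.2)
      (F'' (P.rbEnergy N x) * x.2.2 * x.2.2 + F' (P.rbEnergy N x) * 1) x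
      ((0, (0, 1)) : RBPhaseSpace N) := by
    unfold HasLineDerivAt at h1 h2 ⊢
    have h := h2.mul h1
    simpa [Pi.mul_def] using h
  show lineDeriv ℝ (fun y : RBPhaseSpace N => F' (P.rbEnergy N y) * y.2.2) x
      ((0, (0, 1)) : RBPhaseSpace N) = _
  rw [h12.lineDeriv]
  ring

/-! ### The generator on functions of the energy -/

/-- **The Rey-Bellet–Thomas generator applied to a function of the energy.** For a differentiable
Hamiltonian (e.g. `C¹` potentials) and `F` with `F' = dF/du`, `F'' = dF'/du`:
`L(F∘G) = γ [T_L (F''(G) r_L² + F'(G)) - F'(G) r_L² + T_R (F''(G) r_R² + F'(G)) - F'(G) r_R²]`.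
The Liouville part `p∇_q - ∇_qV ∇_p` and the coupling parts `λ(p_b ∂_{r_b} - r_b ∂_{p_b})` drop
out (`G` is invariant under both flows), and the reservoir parts `γ(T_b ∂²_{r_b} - r_b ∂_{r_b})`
give the displayed Ornstein–Uhlenbeck terms (the computation behind RBT's (28), done for a
general `F` so that it applies to compactly supported cutoffs of `e^{θG}`).
[cite: ReyBelletThomas2002, Lemma 3.5 proof eq. (28)] -/
theorem rbGenerator_comp_rbEnergy (hH : Differentiable ℝ (P.hamiltonian N)) {F F' F'' : ℝ → ℝ}
    (hF : ∀ u, HasDerivAt F (F' u) u) (hF' : ∀ u, HasDerivAt F' (F'' u) u) (Λ T_L T_R : ℝ)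
    (x : RBPhaseSpace N) :
    P.rbGenerator Λ N T_L T_R (fun y => F (P.rbEnergy N y)) x =
      P.γ * (T_L * (F'' (P.rbEnergy N x) * x.2.1 ^ 2 + F' (P.rbEnergy N x)) -
          F' (P.rbEnergy N x) * x.2.1 ^ 2 +
        (T_R * (F'' (P.rbEnergy N x) * x.2.2 ^ 2 + F' (P.rbEnergy N x)) -
          F' (P.rbEnergy N x) * x.2.2 ^ 2)) := by
  simp only [rbGenerator, P.rbPartialQ_comp_rbEnergy hH hF, P.rbPartialP_comp_rbEnergy hF,
    P.partialRL_comp_rbEnergy hF, P.partialRR_comp_rbEnergy hF,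
    P.partialRL_deriv_comp_rbEnergy_mul hF', P.partialRR_deriv_comp_rbEnergy_mul hF']
  have h0 : ∀ i : Fin N, x.1.2 i * (F' (P.rbEnergy N x) * partialQ i (P.hamiltonian N) x.1) -
      partialQ i (P.hamiltonian N) x.1 * (F' (P.rbEnergy N x) * x.1.2 i) = 0 := fun i => by ring
  have hL : ∀ i : Fin N, x.1.2 i * (F' (P.rbEnergy N x) * x.2.1) -
      x.2.1 * (F' (P.rbEnergy N x) * x.1.2 i) = 0 := fun i => by ring
  have hR : ∀ i : Fin N, x.1.2 i * (F' (P.rbEnergy N x) * x.2.2) -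
      x.2.2 * (F' (P.rbEnergy N x) * x.1.2 i) = 0 := fun i => by ring
  simp only [h0, hL, hR, ite_self, add_zero, Finset.sum_const_zero, mul_zero, zero_add]
  ring

/-- **Rey-Bellet–Thomas 2002, eq. (28) (proof of Lemma 3.5), the identity**: for a differentiable
Hamiltonian, every `θ`, `Λ`, `T_L`, `T_R` and every point `x = ((q, p), (r_L, r_R))`,
`L e^{θG}(x) = γθ e^{θG(x)} (T_L + T_R - r_L²(1 - θT_L) - r_R²(1 - θT_R))`
("`L exp(θG(x)) = γθ exp(θG(x)) (Tr(T) - r(1 - θT)r)`").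
[cite: ReyBelletThomas2002, Lemma 3.5 proof eq. (28)] -/
theorem rbGenerator_exp_mul_rbEnergy (hH : Differentiable ℝ (P.hamiltonian N)) (Λ T_L T_R θ : ℝ)
    (x : RBPhaseSpace N) :
    P.rbGenerator Λ N T_L T_R (fun y => Real.exp (θ * P.rbEnergy N y)) x =
      P.γ * θ * Real.exp (θ * P.rbEnergy N x) *
        (T_L + T_R - x.2.1 ^ 2 * (1 - θ * T_L) - x.2.2 ^ 2 * (1 - θ * T_R)) := by
  have hF : ∀ u : ℝ, HasDerivAt (fun u => Real.exp (θ * u)) (θ * Real.exp (θ * u)) u := fun u => by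
    simpa [mul_comm] using ((hasDerivAt_id u).const_mul θ).exp
  have hF' : ∀ u : ℝ, HasDerivAt (fun u => θ * Real.exp (θ * u)) (θ * (θ * Real.exp (θ * u))) u :=
    fun u => (hF u).const_mul θ
  rw [P.rbGenerator_comp_rbEnergy hH hF hF']
  ring

/-- **Rey-Bellet–Thomas 2002, eq. (28), the Lyapunov inequality**: for `γ ≥ 0` and
`0 ≤ θ ≤ (max{T_L, T_R})⁻¹` (spelled `θT_L ≤ 1`, `θT_R ≤ 1`, so that `1 - θT ≥ 0`, Remark 3.6),
`L e^{θG} ≤ γθ Tr(T) e^{θG} = γθ (T_L + T_R) e^{θG}` pointwise — the differential form of the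
"no-runaway" bound `E_x e^{θG(x(t))} ≤ e^{γ Tr(T) θ t} e^{θG(x)}` of Lemma 3.5.
[cite: ReyBelletThomas2002, Lemma 3.5 proof eq. (28)] -/
theorem rbGenerator_exp_mul_rbEnergy_le (hH : Differentiable ℝ (P.hamiltonian N)) (hγ : 0 ≤ P.γ)
    {θ T_L T_R : ℝ} (hθ : 0 ≤ θ) (hL : θ * T_L ≤ 1) (hR : θ * T_R ≤ 1) (Λ : ℝ)
    (x : RBPhaseSpace N) :
    P.rbGenerator Λ N T_L T_R (fun y => Real.exp (θ * P.rbEnergy N y)) x ≤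
      P.γ * θ * (T_L + T_R) * Real.exp (θ * P.rbEnergy N x) := by
  rw [P.rbGenerator_exp_mul_rbEnergy hH]
  have key : 0 ≤ P.γ * θ * Real.exp (θ * P.rbEnergy N x) *
      (x.2.1 ^ 2 * (1 - θ * T_L) + x.2.2 ^ 2 * (1 - θ * T_R)) :=
    mul_nonneg (mul_nonneg (mul_nonneg hγ hθ) (Real.exp_pos _).le)
      (add_nonneg (mul_nonneg (sq_nonneg _) (by linarith)) (mul_nonneg (sq_nonneg _) (by linarith)))
  nlinarith [key]

/-- **Energy balance**: `L G = γ(T_L + T_R) - γ(r_L² + r_R²)` (the reservoirs inject `γ Tr(T)` and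
dissipate `γ r²`; the Hamiltonian and coupling parts conserve `G`). [cite: ReyBelletThomas2002, Lemma 3.5 proof eq. (28)] -/
theorem rbGenerator_rbEnergy (hH : Differentiable ℝ (P.hamiltonian N)) (Λ T_L T_R : ℝ)
    (x : RBPhaseSpace N) :
    P.rbGenerator Λ N T_L T_R (P.rbEnergy N) x =
      P.γ * (T_L + T_R) - P.γ * (x.2.1 ^ 2 + x.2.2 ^ 2) := by
  have hF : ∀ u : ℝ, HasDerivAt (fun u : ℝ => u) ((fun _ : ℝ => (1 : ℝ)) u) u := fun u =>
    hasDerivAt_id u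
  have hF' : ∀ u : ℝ, HasDerivAt (fun _ : ℝ => (1 : ℝ)) ((fun _ : ℝ => (0 : ℝ)) u) u := fun u =>
    hasDerivAt_const u 1
  calc P.rbGenerator Λ N T_L T_R (P.rbEnergy N) x
      = P.rbGenerator Λ N T_L T_R (fun y => (fun u : ℝ => u) (P.rbEnergy N y)) x := rfl
    _ = _ := P.rbGenerator_comp_rbEnergy hH hF hF' Λ T_L T_R x
    _ = P.γ * (T_L + T_R) - P.γ * (x.2.1 ^ 2 + x.2.2 ^ 2) := by ring

end OscillatorChain

end Literature.MathematicalPhysics.KineticTheory.HeatConduction
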